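import Summits.KontsevichZagierPeriods.KontsevichZagierPeriods.Theses.TerasomaMultiplication
import Summits.KontsevichZagierPeriods.KontsevichZagierPeriods.Theorems.MultiplicationThree.Negative.Pinned
import Summits.KontsevichZagierPeriods.KontsevichZagierPeriods.Theorems.MultiplicationThree.Negative.BolzaLever
import Summits.KontsevichZagierPeriods.KontsevichZagierPeriods.Theorems.TerasomaMultiplicationSimplexToMaxCell
import Literature.NumberTheory.Transcendental.KZMellinFibres
import Literature.NumberTheory.Transcendental.KZSubcalculusInvariants
import Literature.NumberTheory.Transcendental.KZDominatedFamilyRelations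
import Literature.NumberTheory.Transcendental.KZLogCalculusProofs
import Literature.NumberTheory.Transcendental.KZSemialgebraicComplex
import Mathlib.Analysis.SpecialFunctions.Pow.Deriv

/-!
# `MultiplicationThree` (stmt-KontsevichZagierPeriods-3598), line `bolza-involution-real-quotient`:
# stub S6 — cyclic symmetry of the simplex

Stub `stub_simplexToMaxCell` of the crux `MultiplicationThree` (route `TerasomaMultiplication`; lead skeleton
`Cruxes/MultiplicationThree/Lines/bolza-involution-real-quotient.lean`).

For every rational `s > 0`, the Dirichlet simplex representation `[Δ, g]`,
`Δ = {σ₁, σ₂ > 0, σ₁ + σ₂ < 3}`, `g = (σ₁σ₂σ₃)^(s-1)`, `σ₃ = 3 − σ₁ − σ₂`, is equivalent in the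
Kontsevich–Zagier calculus to `[M₃, 3g]`, `M₃ = {σ₃ > σ₁, σ₃ > σ₂}` the cell on which `σ₃` is the
largest coordinate.  The chain of moves: `Δ = M₁ ∪ M₂ ∪ M₃ ∪ (three null mirror segments)`, rule (1a)
twice after absorbing the null set; the cyclic affine map `c(σ₁, σ₂) = (σ₂, 3 − σ₁ − σ₂)`
(`|det Dc| = 1`, `g ∘ c = g`) carries `M₂` onto `M₁` and `M₁` onto `M₃`, rule (2) twice; and
`[M₃, 3g] ∼ 3 • [M₃, g]` is rule (1b).

The statement of this stub is verbatim the route item `SimplexToMaxCell`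
(stmt-KontsevichZagierPeriods-14676), whose certified proof
`SimplexToMaxCell.simplexToMaxCell_proof` (file
`Theorems/TerasomaMultiplicationSimplexToMaxCell.lean`, where the cells, the cyclic map, its constant
Jacobian and the six moves are written out) is invoked here; no new definitions are introduced.

References: M. Kontsevich, D. Zagier, *Periods* (2001), §1.2 rules (1), (2); G. Andrews, R. Askey,
R. Roy, *Special Functions* (1999), §1.8 (Dirichlet's simplex integral).
-/

noncomputable section

open Set MeasureTheory MvPolynomial
open Literature.NumberTheory.Transcendental Literature.NumberTheory.Transcendental.KZ
open Literature.ModelTheory.ExponentialFields (IsSemialgebraic)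

namespace Summit.KontsevichZagierPeriods.TerasomaMultiplication.MultiplicationThreeBolza

open Summit.KontsevichZagierPeriods.TerasomaMultiplication.MultiplicationThreeNegative

/-- **Stub S6 (cyclic symmetry of the simplex).** For every rational `s > 0` and all
representations `r = [Δ, (σ₁σ₂(3−σ₁−σ₂))^(s−1)]` (`Δ = {σ₁ > 0, σ₂ > 0, σ₁ + σ₂ < 3}`) and
`r' = [M₃, 3(σ₁σ₂(3−σ₁−σ₂))^(s−1)]` (`M₃ = {σ₁ > 0, σ₂ > 0, σ₁ < σ₃, σ₂ < σ₃}`, `σ₃ = 3 − σ₁ − σ₂`),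
`r ∼ r'` in the Kontsevich–Zagier calculus: split `Δ` into the three cells `Mᵢ = {σᵢ largest}`
(rule (1a), the mirror segments being null), move `M₁`, `M₂` onto `M₃` by the cyclic affine map
`c(σ₁, σ₂) = (σ₂, 3 − σ₁ − σ₂)` and its square (rule (2), `|det| = 1`, `g ∘ c = g`), and add the
three copies (rule (1b)).  This is the text of route item `SimplexToMaxCell`, proved as
`SimplexToMaxCell.simplexToMaxCell_proof`. [folklore] -/
theorem stub_simplexToMaxCell :
    ∀ s : ℚ, 0 < s → ∀ (r r' : Literature.NumberTheory.Transcendental.KZ.IntegralRep 2), r.domain = {x | 0 < x 0 ∧ 0 < x 1 ∧ x 0 + x 1 < 3} → Set.EqOn r.integrand (fun x => (x 0 * x 1 * (3 - x 0 - x 1)) ^ ((s:ℝ) - 1)) r.domain → r'.domain = {x | 0 < x 0 ∧ 0 < x 1 ∧ x 0 < 3 - x 0 - x 1 ∧ x 1 < 3 - x 0 - x 1} → Set.EqOn r'.integrand (fun x => 3 * (x 0 * x 1 * (3 - x 0 - x 1)) ^ ((s:ℝ) - 1)) r'.domain → Literature.NumberTheory.Transcendental.KZ.Equivalent r r' :=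
  fun s hs r r' hr hri hr' hri' =>
    Summit.KontsevichZagierPeriods.TerasomaMultiplication.SimplexToMaxCell.simplexToMaxCell_proof
      s hs r r' hr hri hr' hri'

end Summit.KontsevichZagierPeriods.TerasomaMultiplication.MultiplicationThreeBolza

end
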